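import Summits.MatrixMultiplication.OmegaCensus.SmallFormats.MatMul22nRankGF5XCapSymmetryData2
import Summits.MatrixMultiplication.OmegaCensus.SmallFormats.MatMul22nRankGF5XCapParity
import HarnessLib

/-!
# ω-census family (a): symmetry transport for the X-cap system over `𝔽₅` (the 350 cap / row-plane rows)

Cell `pub-omega` (unit `pub-omega-tensor-g11`), topic `Summits/MatrixMultiplication/OmegaCensus` (sub-folder `SmallFormats`).
Framing (verbatim): lottery ticket; floor = certified bounds/negative ranges. HONEST FRAMING: bookkeeping, no bound on a rank, not
progress on `ω`. If `σ` is a permutation of the 157 variables and `ρ` a map of the rows with `rowMem5 (ρ r) (σ j) = rowMem5 r j`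
(`r < 350`, `j < 157`) preserving the row kind, then `x ↦ x ∘ σ` preserves feasibility of the 350 cap / row-plane rows of `xcapSys5s s`
(`rows350_comp`), the total (`total_comp`) and hence (with `MatMul22nRankGF5XCapParity`) tightness and rectangle parity. Instances:
the four generators `La, Lb, Ra, Rb` of `PGL₂(5) × PGL₂(5)` tabulated in `MatMul22nRankGF5XCapSymmetryData{,2}`. PURPOSE: the
WLOG-by-symmetry layer of the successor blueprint for the kernel replay of `M₅(4) ≤ 111` (`pub-omega-tensor-g11/METHOD-PARITY-g11.md`):
normal forms are reached by words in these generators instead of the two hard-wired sandwiches of `exists_wlog_transport`.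
-/

namespace Summit.MatrixMultiplication.OmegaCensus.SmallFormats

open Finset

/-- For `r < 350`, `j < 157` the coefficient of the slack-`s` system is the membership indicator of the row table. -/
theorem xcapSys5s_A_mem (s : ℕ) {r j : ℕ} (hr : r < 350) (hj : j < 157) :
    (xcapSys5s s).A r j = if rowMem5 r j then 1 else 0 := by
  rw [xcapSys5s_A, xcapSys5_A_eq' (by omega) hj, rowCoef5_eq_mem' hr hj]

section transport

variable {σ σi ρ : ℕ → ℕ}
  (hσ : ∀ j < 157, σ j < 157) (hσi : ∀ j < 157, σi j < 157)
  (h1 : ∀ j < 157, σi (σ j) = j) (h2 : ∀ j < 157, σ (σi j) = j)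

include hσ hσi h1 h2

/-- The total `∑_{j<157} x_j` is invariant under a permutation of the variables. -/
theorem total_comp (x : ℕ → ℕ) : ∑ j ∈ range 157, (x (σ j) : ℤ) = ∑ j ∈ range 157, (x j : ℤ) :=
  sum_nbij' σ σi (fun a ha => mem_range.2 (hσ a (mem_range.1 ha))) (fun a ha => mem_range.2 (hσi a (mem_range.1 ha)))
    (fun a ha => h1 a (mem_range.1 ha)) (fun a ha => h2 a (mem_range.1 ha)) (fun _ _ => rfl)

variable (hρ : ∀ r < 350, ρ r < 350) (hmem : ∀ r < 350, ∀ j < 157, rowMem5 (ρ r) (σ j) = rowMem5 r j)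

include hρ hmem

/-- Row values are transported: row `r` of `x ∘ σ` is row `ρ r` of `x`. -/
theorem rowVal5_comp (s : ℕ) (x : ℕ → ℕ) {r : ℕ} (hr : r < 350) :
    rowVal5 s (fun j => x (σ j)) r = rowVal5 s x (ρ r) := by
  unfold rowVal5
  have hρr := hρ r hr
  have eL : ∀ j ∈ range 157, (xcapSys5s s).A r j * ((x (σ j) : ℕ) : ℤ)
      = (if rowMem5 (ρ r) (σ j) then (1 : ℤ) else 0) * (x (σ j) : ℤ) := by
    intro j hj
    rw [xcapSys5s_A_mem s hr (mem_range.1 hj), ← hmem r hr j (mem_range.1 hj)]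
  have eR : ∀ k ∈ range 157, (xcapSys5s s).A (ρ r) k * (x k : ℤ) = (if rowMem5 (ρ r) k then (1 : ℤ) else 0) * (x k : ℤ) := by
    intro k hk
    rw [xcapSys5s_A_mem s hρr (mem_range.1 hk)]
  rw [sum_congr rfl eL, sum_congr rfl eR]
  exact sum_nbij' σ σi (fun a ha => mem_range.2 (hσ a (mem_range.1 ha))) (fun a ha => mem_range.2 (hσi a (mem_range.1 ha)))
    (fun a ha => h1 a (mem_range.1 ha)) (fun a ha => h2 a (mem_range.1 ha)) (fun _ _ => rfl)

/-- **Transport.** Feasibility of the 350 cap / row-plane rows is invariant under a tabulated symmetry preserving the row kind. -/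
theorem rows350_comp (hkind : ∀ r < 350, (ρ r < 344 ↔ r < 344)) {s : ℕ} {x : ℕ → ℕ}
    (h : ∀ r < 350, rowVal5 s x r ≤ rhs5s s r) : ∀ r < 350, rowVal5 s (fun j => x (σ j)) r ≤ rhs5s s r := by
  intro r hr
  rw [rowVal5_comp hσ hσi h1 h2 hρ hmem s x hr]
  have h350 := hρ r hr
  have hk : rhs5s s (ρ r) = rhs5s s r := by
    have hiff := hkind r hr
    by_cases h344 : r < 344
    · have : ρ r < 344 := hiff.2 h344
      simp [rhs5s, h344, this]
    · have : ¬ ρ r < 344 := fun h' => h344 (hiff.1 h')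
      simp [rhs5s, h344, this, h350, show r < 350 from hr]
  rw [← hk]
  exact h (ρ r) h350

end transport

/-! ## The four generators -/

/-- Transport by `La` (left multiplication by `[[1,1],[0,1]]`). -/
theorem rows350_La {s : ℕ} {x : ℕ → ℕ} (h : ∀ r < 350, rowVal5 s x r ≤ rhs5s s r) :
    ∀ r < 350, rowVal5 s (fun j => x (sigLa j)) r ≤ rhs5s s r :=
  rows350_comp (fun j hj => (sigLa_bij.1 ⟨j, hj⟩).1) (fun j hj => (sigLa_bij.1 ⟨j, hj⟩).2.1)
    (fun j hj => (sigLa_bij.1 ⟨j, hj⟩).2.2.1) (fun j hj => (sigLa_bij.1 ⟨j, hj⟩).2.2.2)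
    (fun r hr => (rhoLa_kind ⟨r, hr⟩).1) (fun _ hr _ hj => memEq_La hr hj) (fun r hr => (rhoLa_kind ⟨r, hr⟩).2) h

/-- Transport by `Lb` (left multiplication by `[[0,1],[2,0]]`). -/
theorem rows350_Lb {s : ℕ} {x : ℕ → ℕ} (h : ∀ r < 350, rowVal5 s x r ≤ rhs5s s r) :
    ∀ r < 350, rowVal5 s (fun j => x (sigLb j)) r ≤ rhs5s s r :=
  rows350_comp (fun j hj => (sigLb_bij.1 ⟨j, hj⟩).1) (fun j hj => (sigLb_bij.1 ⟨j, hj⟩).2.1)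
    (fun j hj => (sigLb_bij.1 ⟨j, hj⟩).2.2.1) (fun j hj => (sigLb_bij.1 ⟨j, hj⟩).2.2.2)
    (fun r hr => (rhoLb_kind ⟨r, hr⟩).1) (fun _ hr _ hj => memEq_Lb hr hj) (fun r hr => (rhoLb_kind ⟨r, hr⟩).2) h

/-- Transport by `Ra` (right multiplication by `[[1,1],[0,1]]`). -/
theorem rows350_Ra {s : ℕ} {x : ℕ → ℕ} (h : ∀ r < 350, rowVal5 s x r ≤ rhs5s s r) :
    ∀ r < 350, rowVal5 s (fun j => x (sigRa j)) r ≤ rhs5s s r :=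
  rows350_comp (fun j hj => (sigRa_bij.1 ⟨j, hj⟩).1) (fun j hj => (sigRa_bij.1 ⟨j, hj⟩).2.1)
    (fun j hj => (sigRa_bij.1 ⟨j, hj⟩).2.2.1) (fun j hj => (sigRa_bij.1 ⟨j, hj⟩).2.2.2)
    (fun r hr => (rhoRa_kind ⟨r, hr⟩).1) (fun _ hr _ hj => memEq_Ra hr hj) (fun r hr => (rhoRa_kind ⟨r, hr⟩).2) h

/-- Transport by `Rb` (right multiplication by `[[0,1],[2,0]]`). -/
theorem rows350_Rb {s : ℕ} {x : ℕ → ℕ} (h : ∀ r < 350, rowVal5 s x r ≤ rhs5s s r) :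
    ∀ r < 350, rowVal5 s (fun j => x (sigRb j)) r ≤ rhs5s s r :=
  rows350_comp (fun j hj => (sigRb_bij.1 ⟨j, hj⟩).1) (fun j hj => (sigRb_bij.1 ⟨j, hj⟩).2.1)
    (fun j hj => (sigRb_bij.1 ⟨j, hj⟩).2.2.1) (fun j hj => (sigRb_bij.1 ⟨j, hj⟩).2.2.2)
    (fun r hr => (rhoRb_kind ⟨r, hr⟩).1) (fun _ hr _ hj => memEq_Rb hr hj) (fun r hr => (rhoRb_kind ⟨r, hr⟩).2) h

/-- Totals are invariant under the four generators. -/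
theorem total_La (x : ℕ → ℕ) : ∑ j ∈ range 157, (x (sigLa j) : ℤ) = ∑ j ∈ range 157, (x j : ℤ) :=
  total_comp (fun j hj => (sigLa_bij.1 ⟨j, hj⟩).1) (fun j hj => (sigLa_bij.1 ⟨j, hj⟩).2.1)
    (fun j hj => (sigLa_bij.1 ⟨j, hj⟩).2.2.1) (fun j hj => (sigLa_bij.1 ⟨j, hj⟩).2.2.2) x

/-- Totals are invariant under `Lb`. -/
theorem total_Lb (x : ℕ → ℕ) : ∑ j ∈ range 157, (x (sigLb j) : ℤ) = ∑ j ∈ range 157, (x j : ℤ) :=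
  total_comp (fun j hj => (sigLb_bij.1 ⟨j, hj⟩).1) (fun j hj => (sigLb_bij.1 ⟨j, hj⟩).2.1)
    (fun j hj => (sigLb_bij.1 ⟨j, hj⟩).2.2.1) (fun j hj => (sigLb_bij.1 ⟨j, hj⟩).2.2.2) x

/-- Totals are invariant under `Ra`. -/
theorem total_Ra (x : ℕ → ℕ) : ∑ j ∈ range 157, (x (sigRa j) : ℤ) = ∑ j ∈ range 157, (x j : ℤ) :=
  total_comp (fun j hj => (sigRa_bij.1 ⟨j, hj⟩).1) (fun j hj => (sigRa_bij.1 ⟨j, hj⟩).2.1)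
    (fun j hj => (sigRa_bij.1 ⟨j, hj⟩).2.2.1) (fun j hj => (sigRa_bij.1 ⟨j, hj⟩).2.2.2) x

/-- Totals are invariant under `Rb`. -/
theorem total_Rb (x : ℕ → ℕ) : ∑ j ∈ range 157, (x (sigRb j) : ℤ) = ∑ j ∈ range 157, (x j : ℤ) :=
  total_comp (fun j hj => (sigRb_bij.1 ⟨j, hj⟩).1) (fun j hj => (sigRb_bij.1 ⟨j, hj⟩).2.1)
    (fun j hj => (sigRb_bij.1 ⟨j, hj⟩).2.2.1) (fun j hj => (sigRb_bij.1 ⟨j, hj⟩).2.2.2) x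

end Summit.MatrixMultiplication.OmegaCensus.SmallFormats
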